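import Mathlib.Algebra.MvPolynomial.NoZeroDivisors
import Literature.Computability.AlgebraicComplexity.DeterminantalComplexity
import Literature.Computability.AlgebraicComplexity.StandardFamiliesProofs
import Literature.Computability.AlgebraicComplexity.RankOneDeterminantalExpressionsProofs

/-!
# `UlrichPadded.OrbitCorankTwo` (stmt-ValiantsHypothesis-15032): the guard `3 ≤ n` is load-bearing

Negative knowledge for the crux (standing disprover, cycle 1, 2026-08-16).  The crux says: for `n ≥ 3`
every affine determinantal representation `A` of `per_n` has an affine gauge form `P·A·Q`
(`P, Q ∈ GL_m(ℂ[x])`) all of whose submaximal minors of the LINEAR PART lie in `(per_n)`.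

* `exists_adjugate_linPart_notMem_two`: at `n = m = 2` the conclusion fails in EVERY gauge — a
  `2 × 2` affine matrix with `det = per₂` has a nonzero linear entry, i.e. a submaximal minor of its
  linear part of degree `1 < 2`;
* `orbitCorankTwo_false_from_two`: hence the crux with `3 ≤ n` weakened to `2 ≤ n` (everything else
  verbatim) is FALSE, witness `A₂ = [[x₀₀, -x₀₁], [x₁₀, x₁₁]]`;
* `isUnit_of_gauge_detRepr`: the conjuncts `IsUnit P ∧ IsUnit Q` of the crux are implied by the
  other two (`det A = per_n = det (P·A·Q)`, `per_n ≠ 0`) — information for provers.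

So any proof must use `n ≥ 3` (it enters through `m > n`, Mignon–Ressayre / `NoGlobalSplitting`, and
through factoriality of `ℂ[x]/(per_n)`).  Statements inline (the weakened crux is the ledger signature of
stmt-ValiantsHypothesis-15032 with `3 ≤ n` replaced by `2 ≤ n`), no new facts; imports are Literature-only on
purpose (the file does not depend on the route file).
-/

noncomputable section

namespace Summit.ValiantsHypothesis.Theorems.OrbitCorankTwoNegative

open MvPolynomial Matrix
open Literature.Computability.AlgebraicComplexity

/-- A multiple of `per₂` of total degree `< 2` is zero (`per₂` is a nonzero quadratic form and `ℂ[x]` is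
a domain; the `n = 2` instance of `RankOneTrivialisationNegative.eq_zero_of_mem_span_perPoly`,
re-proved here to keep this file independent of the route file). [folklore] -/
theorem eq_zero_of_mem_span_perPoly_two {q : MvPolynomial (Fin 2 × Fin 2) ℂ}
    (hq : q ∈ Ideal.span {perPoly (Fin 2) ℂ}) (hdeg : q.totalDegree < 2) : q = 0 := by
  obtain ⟨k, rfl⟩ := Ideal.mem_span_singleton.1 hq
  by_contra hne
  have hk : k ≠ 0 := by
    rintro rfl
    exact hne (mul_zero _)
  have hper : perPoly (Fin 2) ℂ ≠ 0 := perPoly_ne_zero (Fin 2) ℂ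
  have hdegper : (perPoly (Fin 2) ℂ).totalDegree = 2 := by
    simpa [Fintype.card_fin] using
      (perPoly_isHomogeneous (n := Fin 2) (k := ℂ)).totalDegree hper
  rw [totalDegree_mul_of_isDomain hper hk, hdegper] at hdeg
  omega

/-- An affine-linear polynomial with vanishing linear part is a constant. [folklore] -/
theorem eq_C_of_totalDegree_le_one {σ : Type*} (φ : MvPolynomial σ ℂ) (h1 : φ.totalDegree ≤ 1)
    (h0 : homogeneousComponent 1 φ = 0) : φ = C (coeff 0 φ) := by
  rcases Nat.lt_or_ge φ.totalDegree 1 with hlt | hge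
  · exact totalDegree_eq_zero_iff_eq_C.1 (by omega)
  · have hd : φ.totalDegree = 1 := le_antisymm h1 hge
    have hs := sum_homogeneousComponent φ
    rw [hd, Finset.sum_range_succ, Finset.sum_range_one, h0, add_zero, homogeneousComponent_zero] at hs
    exact hs.symm

/-- At `n = m = 2` the conclusion of the crux fails in EVERY gauge: a `2 × 2` matrix `B` of affine
linear forms with `det B = per₂` has a submaximal minor of its linear part (an entry, up to sign)
outside `(per₂)` — otherwise all linear parts vanish, `B` is constant and `det B = per₂` is not. [folklore] -/
theorem exists_adjugate_linPart_notMem_two (B : Matrix (Fin 2) (Fin 2) (MvPolynomial (Fin 2 × Fin 2) ℂ))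
    (hB : IsAffineDetRepr (perPoly (Fin 2) ℂ) B) :
    ∃ i j, (Matrix.of fun a b => homogeneousComponent 1 (B a b)).adjugate i j ∉
      Ideal.span {perPoly (Fin 2) ℂ} := by
  by_contra hex
  have h : ∀ i j, (Matrix.of fun a b => homogeneousComponent 1 (B a b)).adjugate i j ∈
      Ideal.span {perPoly (Fin 2) ℂ} := fun i j => by
    by_contra hij
    exact hex ⟨i, j, hij⟩
  have hdeg : ∀ a b, (homogeneousComponent 1 (B a b)).totalDegree < 2 := fun a b =>
    lt_of_le_of_lt (homogeneousComponent_isHomogeneous 1 (B a b)).totalDegree_le one_lt_two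
  have hadj := h
  simp only [Matrix.adjugate_fin_two, Matrix.of_apply, Matrix.cons_val', Matrix.empty_val',
    Matrix.cons_val_fin_one] at hadj
  have h11 : homogeneousComponent 1 (B 1 1) = 0 :=
    eq_zero_of_mem_span_perPoly_two (by simpa using hadj 0 0) (hdeg 1 1)
  have h01 : homogeneousComponent 1 (B 0 1) = 0 :=
    eq_zero_of_mem_span_perPoly_two (by simpa using hadj 0 1) (hdeg 0 1)
  have h10 : homogeneousComponent 1 (B 1 0) = 0 :=
    eq_zero_of_mem_span_perPoly_two (by simpa using hadj 1 0) (hdeg 1 0)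
  have h00 : homogeneousComponent 1 (B 0 0) = 0 :=
    eq_zero_of_mem_span_perPoly_two (by simpa using hadj 1 1) (hdeg 0 0)
  obtain ⟨c, hc⟩ : ∃ c : Fin 2 → Fin 2 → ℂ, ∀ a b, B a b = C (c a b) := by
    refine ⟨fun a b => coeff 0 (B a b), fun a b => eq_C_of_totalDegree_le_one _ (hB.1 a b) ?_⟩
    fin_cases a <;> fin_cases b <;> assumption
  have hdet : B.det = C (c 0 0 * c 1 1 - c 0 1 * c 1 0) := by
    rw [Matrix.det_fin_two, hc 0 0, hc 0 1, hc 1 0, hc 1 1]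
    simp only [map_mul, map_sub]
  have hper2 : perPoly (Fin 2) ℂ = X (0, 0) * X (1, 1) + X (1, 0) * X (0, 1) := by
    simp [perPoly, permanent_fin_two, Matrix.mvPolynomialX_apply]
  have key := hB.2
  rw [hdet, hper2] at key
  have e1 := congr_arg (eval fun _ : Fin 2 × Fin 2 => (1 : ℂ)) key
  have e0 := congr_arg (eval fun _ : Fin 2 × Fin 2 => (0 : ℂ)) key
  simp only [eval_C, map_add, map_mul, eval_X] at e1 e0
  rw [e0] at e1
  norm_num at e1

/-- **`3 ≤ n` is load-bearing in `OrbitCorankTwo`.**  With the guard weakened to `2 ≤ n` (everything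
else verbatim) the crux is false: witness `n = m = 2`, `A₂ = [[x₀₀, -x₀₁], [x₁₀, x₁₁]]`, `det A₂ = per₂`;
by `exists_adjugate_linPart_notMem_two` no gauge form `P·A₂·Q` has all submaximal minors of its linear
part in `(per₂)`. (Any proof must use `n ≥ 3`; it enters through `m > n` — Mignon–Ressayre /
`NoGlobalSplitting` — and through factoriality of `ℂ[x]/(per_n)`.) [folklore] -/
theorem orbitCorankTwo_false_from_two :
    ¬ ∀ n : ℕ, 2 ≤ n → ∀ (m : ℕ) (A : Matrix (Fin m) (Fin m) (MvPolynomial (Fin n × Fin n) ℂ)),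
      IsAffineDetRepr (perPoly (Fin n) ℂ) A →
      ∃ P Q : Matrix (Fin m) (Fin m) (MvPolynomial (Fin n × Fin n) ℂ), IsUnit P ∧ IsUnit Q ∧
        IsAffineDetRepr (perPoly (Fin n) ℂ) (P * A * Q) ∧
        ∀ i j, (Matrix.of fun a b => homogeneousComponent 1 ((P * A * Q) a b)).adjugate i j ∈
          Ideal.span {perPoly (Fin n) ℂ} := by
  intro h
  obtain ⟨A₂, hA₂⟩ : ∃ M : Matrix (Fin 2) (Fin 2) (MvPolynomial (Fin 2 × Fin 2) ℂ),
      M = !![X (0, 0), -X (0, 1); X (1, 0), X (1, 1)] := ⟨_, rfl⟩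
  have hper2 : perPoly (Fin 2) ℂ = X (0, 0) * X (1, 1) + X (1, 0) * X (0, 1) := by
    simp [perPoly, permanent_fin_two, Matrix.mvPolynomialX_apply]
  have hrepr : IsAffineDetRepr (perPoly (Fin 2) ℂ) A₂ := by
    refine ⟨fun i j => ?_, ?_⟩
    · rw [hA₂]
      fin_cases i <;> fin_cases j <;> simp [totalDegree_X, totalDegree_neg]
    · rw [Matrix.det_fin_two, hper2, hA₂]
      simp
      ring
  obtain ⟨P, Q, -, -, hPAQ, hmem⟩ := h 2 le_rfl 2 A₂ hrepr
  obtain ⟨i, j, hij⟩ := exists_adjugate_linPart_notMem_two (P * A₂ * Q) hPAQ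
  exact hij (hmem i j)

/-- If `det A = f ≠ 0` and `det (P·A·Q) = f` over a domain then `P` and `Q` are unimodular: the crux's
`IsUnit P ∧ IsUnit Q` follows from the other two conjuncts. [folklore] -/
theorem isUnit_of_gauge_detRepr {σ : Type*} {m : Type*} [Fintype m] [DecidableEq m]
    {f : MvPolynomial σ ℂ} (hf : f ≠ 0) {A P Q : Matrix m m (MvPolynomial σ ℂ)}
    (hA : A.det = f) (hPAQ : (P * A * Q).det = f) : IsUnit P ∧ IsUnit Q := by
  rw [Matrix.det_mul, Matrix.det_mul, hA] at hPAQ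
  have h1 : P.det * Q.det = 1 := by
    have : (P.det * Q.det - 1) * f = 0 := by rw [sub_mul, one_mul, sub_eq_zero]; linear_combination hPAQ
    rcases mul_eq_zero.1 this with h | h
    · exact sub_eq_zero.1 h
    · exact absurd h hf
  exact ⟨(Matrix.isUnit_iff_isUnit_det P).2 (IsUnit.of_mul_eq_one _ h1),
    (Matrix.isUnit_iff_isUnit_det Q).2 (IsUnit.of_mul_eq_one_right _ h1)⟩

end Summit.ValiantsHypothesis.Theorems.OrbitCorankTwoNegative
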